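import Summits.QuantumFields.BalabanUV.Beta.GAN24.MonotoneComposite

/-!
# Beta / GAN24 / MonotoneCoarsen — COARSENING MONOTONICITY of constrained covariances: one averaging step that does not increase the
# fine energy makes the decimated fluctuation covariance DECREASE, on gauge-INVARIANT sources regardless of the gauge slice
# (gan24-p4 gen 2, BINDER-OWNERS row G-an2-4 ∕ (CONV-C), ALTERNATIVE DISCHARGE «rate OR monotonicity»; NOT IN PRINT — our proof attempt)

HONEST FRAMING (page 1 of everything the β sub-cell writes): discharging `BetaPertH` makes Bałaban's UV stability UNCONDITIONAL — a
real constructive-QFT result; it is NOT the continuum limit and NOT the Clay problem.  HONEST DEPENDENCY (cell reorg 2026-08-19, verbatim):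
«continuum YM on T⁴ ⇐ BetaPertH ∧ nine spine estimates (0/9 proved); BetaPertH ⇐ (D1) ∧ (D4) ∧ CAP+tail; G-an2-4 gates asym, D1 and NE2/3/4.»
HONEST LABEL: «not in print; our proof attempt; alternative discharge of the G-an2-4 row (rate OR monotonicity)»; 0 wall binders instantiated.

ABSOLUTE RULE (cell charter, verbatim): "No internally-minted statement may enter as a cited fact. Every hypothesis is either
kernel-proved in this package or a verbatim quotation of a PUBLISHED theorem with page reference. The manuscript(s) under audit are
NOT citable for their own disputed steps — they are the thing under adjudication; programme-internal (2001/route/tribunal) claims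
are never citable."  Nothing is cited; [folklore] finite-dimensional linear algebra throughout; no `def … : Prop` is asserted of anything
(`IsCrit` is a parameter-carrying predicate with a body).

## WHY (the located term of road P4, `HOME/b2b-balaban-gan24-p4/MONOTONE.md` §4/§6, and what gen 2's diagnostic found)
Gen 1 reduced the rate-free tail of `β⁰_{k+1}` to (MONO-K)₂ for the wall's resolvent slot and proved it for every presentation of the slot as
p3-blocks over an INCREASING tower of effective forms, leaving ONE inequality per step, (OSD_j) `Δ_eff(H (j+1), Qf j) ≥ H j`
(`MonotoneComposite`), untyped for the β lane's weak-block-gauge system.  The DIAGNOSTIC of gen 2 (kit job `j078405`, float64, gan24-p1's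
validated closed form S1b′ of the decimated weak-gauge fibre slot `k_j(p)`; `HOME/b2b-balaban-gan24-p4/gen2/LOEWNER-DIAG.md`) finds: the
field–field block restricted to TRANSVERSE (co-closed) sub-block test forms is Loewner-ANTITONE in `j` at EVERY tested `(D, Lc, j, p)` to
rounding (min eigenvalue `≥ −2·10⁻¹³`), while on pure-gauge test forms the first one or two steps FAIL (min eigenvalues `−2·10⁻³ … −10⁻⁴`).
THIS FILE PROVES THE MECHANISM: the Gaussian variational principle.

## WHAT IS PROVED
* §1 (degenerate forms allowed; no inverse, no gauge fixing).  `qfun H r v = ⟨r,v⟩ + ⟨v,r⟩ − ⟨v,Hv⟩`; `IsCrit H r K v` («`v ∈ K` and `r − Hv ⊥ K`»).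
  `qfun_le_of_isCrit` (PSD `H`: a critical point MAXIMISES `qfun` on `K`), `qfun_crit_eq_pairing` (its value is `⟨r,v⟩`), `pairing_eq_of_isCrit`
  (**slice independence**: two critical points on the same `K` — e.g. the KKT solutions of two different gauge slices whose gauge multiplier does
  no work on `K` — have the same pairing), `isCrit_ker_of_kkt` (KKT stationarity `Hv − r = Aᴴλ`, `Av = 0` ⟹ critical on `ker A`),
  `qfun_coarsen_le` (**(STAB)** `Cᴴ H_c C ≤ H_f` ⟹ `qfun H_f (Cᴴr) v ≤ qfun H_c r (Cv)`), and **`pairing_coarsen_le`**: (STAB), `C K_f ⊆ K_c`,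
  `v_f` critical for `(H_f, Cᴴr)` on `K_f`, `v_c` critical for `(H_c, r)` on `K_c` ⟹ `⟨Cᴴr, v_f⟩ ≤ ⟨r, v_c⟩` — the decimated fine covariance is
  BELOW the coarse one on every source `r`, whatever slices produced `v_f, v_c`, as long as both are critical on the gauge-FREE constraint spaces.
* §2 (positive definite forms; p3's `pivot ∕ effForm ∕ flucCov`).  `pivot_coarsen_le` ((STAB) ⟹ `C H_f⁻¹ Cᴴ ≤ H_c⁻¹`), **`effForm_coarsen_ge`**
  ((STAB) ⟹ (OSD): `H_c ≤ Δ_eff(H_f, C)`), `form_sub_effForm_conj` (`Cᴴ Δ_eff(H_f,C) C ≤ H_f`), **`stab_of_osd`** ((OSD) ⟹ (STAB)) — so gen 1's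
  located inequality (OSD_j) IS «one averaging step does not increase the energy»; `flucCov_coarsen_antitone`
  (`C Γ(H_f, Q C) Cᴴ ≤ Γ(H_c, Q)`, p3's `decimate_flucCov_comp` + gen 1's `flucCov_antitone`), `effForm_coarsen_monotone`.
* §3 the tower of `MonotoneComposite` with (STAB_j) `(Qf j)ᴴ (H j) (Qf j) ≤ H (j+1)` in place of (OSD_j): `effForm_chain_step_of_stab`,
  `flucCov_chain_step_of_stab`, and over `ℂ` `flucCov_entry_dev_le_of_stab` ((MONO-K)₂ for the `Γ`-block from ONE trace datum).
WHAT (STAB) IS for Bałaban's gauge-invariant forms: the sharp lower half of (1.67) with constant `1` between consecutive lattices (in the tree for the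
(1.66) form on tori: asym1 `MonotoneScales.d1Sq_le_formDk`; for the (1.65) operator: `Beta.Ineq167Operator.ineq167_lower`, Federbush's stability of
the averaging map) — NOT instantiated here (0 binders instantiated); the composition of readings `R (j+1) = R j * Qf j` is (1.17); the criticality of
the wall's KKT columns on the gauge-FREE constraint space for co-closed sources is an5's `ResolventComposition.wM_eq_zero` ∕ p3's
`PropagatorWoodburyFibreGauge.gaugeMultiplier_eq_zero` (the gauge multiplier vanishes).  NOT BetaPertH, NOT continuum, NOT Clay.
-/

namespace Summit.QuantumFields.BalabanUV.Beta.GAN24.MonotoneCoarsen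

open Matrix
open Summit.QuantumFields.BalabanUV.Beta.PropagatorWoodburyFibre
open Summit.QuantumFields.BalabanUV.Beta.GAN24.MonotoneBlocks (star_mulVec_dotProduct pairing_sub_form_le inv_antitone effForm_monotone
  flucCov_antitone)

/-! ## §1 The Gaussian variational principle on a subspace (degenerate forms, no gauge fixing) -/

section Variational

variable {𝕜 : Type*} [Field 𝕜] [PartialOrder 𝕜] [StarRing 𝕜] [StarOrderedRing 𝕜]
variable {n : Type*} [Fintype n]

/-- The concave quadratic functional of the Gaussian variational principle: `qfun H r v = ⟨r,v⟩ + ⟨v,r⟩ − ⟨v,Hv⟩`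
(its supremum over the admissible subspace is the covariance pairing `⟨r, Γ r⟩`). [folklore] -/
def qfun (H : Matrix n n 𝕜) (r v : n → 𝕜) : 𝕜 := star r ⬝ᵥ v + star v ⬝ᵥ r - star v ⬝ᵥ (H *ᵥ v)

/-- CRITICAL POINT of `qfun H r` on a subspace `K`: `v ∈ K` and `r − Hv ⊥ K`.  For the KKT solution of a constrained Gaussian this holds on the
kernel of ALL hard rows (`isCrit_ker_of_kkt`); it holds on the larger gauge-FREE kernel exactly when the gauge multiplier does no work there.
A parameter-carrying predicate; nothing asserted. [folklore] -/
def IsCrit (H : Matrix n n 𝕜) (r : n → 𝕜) (K : Submodule 𝕜 (n → 𝕜)) (v : n → 𝕜) : Prop :=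
  v ∈ K ∧ ∀ w ∈ K, star w ⬝ᵥ (r - H *ᵥ v) = 0

omit [PartialOrder 𝕜] [StarOrderedRing 𝕜] in
/-- Moving a RECTANGULAR matrix across the sesquilinear pairing: `⟨M v, w⟩ = ⟨v, Mᴴ w⟩` (gen 1's `MonotoneBlocks.star_mulVec_dotProduct` is the
square case). [folklore] -/
theorem conj_pairing {m : Type*} [Fintype m] (M : Matrix m n 𝕜) (v : n → 𝕜) (w : m → 𝕜) :
    star (M *ᵥ v) ⬝ᵥ w = star v ⬝ᵥ (Mᴴ *ᵥ w) := by
  rw [star_mulVec, ← dotProduct_mulVec]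

omit [PartialOrder 𝕜] [StarOrderedRing 𝕜] in
/-- Expansion of `qfun` around a point: `qfun (v + w) = qfun v + (⟨w, r − Hv⟩ + ⟨r − Hv, w⟩) − ⟨w,Hw⟩` (`H` Hermitian). [folklore] -/
theorem qfun_add {H : Matrix n n 𝕜} (hH : H.IsHermitian) (r v w : n → 𝕜) :
    qfun H r (v + w) = qfun H r v + (star w ⬝ᵥ (r - H *ᵥ v) + star (r - H *ᵥ v) ⬝ᵥ w) - star w ⬝ᵥ (H *ᵥ w) := by
  have e1 : star v ⬝ᵥ (H *ᵥ w) = star (H *ᵥ v) ⬝ᵥ w := by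
    rw [star_mulVec_dotProduct, hH.eq]
  simp only [qfun, star_add, star_sub, mulVec_add, add_dotProduct, dotProduct_add, sub_dotProduct, dotProduct_sub, e1]
  abel

/-- **A CRITICAL POINT MAXIMISES** `qfun H r` on `K` when `H` is positive SEMIdefinite (degenerate gauge directions allowed):
`qfun H r v ≤ qfun H r v⋆` for every `v ∈ K`. [folklore] -/
theorem qfun_le_of_isCrit {H : Matrix n n 𝕜} (hH : H.PosSemidef) {r : n → 𝕜} {K : Submodule 𝕜 (n → 𝕜)} {vs : n → 𝕜}
    (hcrit : IsCrit H r K vs) {v : n → 𝕜} (hv : v ∈ K) : qfun H r v ≤ qfun H r vs := by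
  have hw : v - vs ∈ K := K.sub_mem hv hcrit.1
  have h1 : star (v - vs) ⬝ᵥ (r - H *ᵥ vs) = 0 := hcrit.2 _ hw
  have h2 : star (r - H *ᵥ vs) ⬝ᵥ (v - vs) = 0 := by
    have h := congrArg star h1
    rwa [star_dotProduct, star_star, star_zero] at h
  have e : v = vs + (v - vs) := by abel
  rw [e, qfun_add hH.isHermitian, h1, h2, add_zero, add_zero]
  exact sub_le_self _ (hH.dotProduct_mulVec_nonneg _)

omit [PartialOrder 𝕜] [StarOrderedRing 𝕜] in
/-- **THE VALUE AT A CRITICAL POINT IS THE PAIRING**: `qfun H r v⋆ = ⟨r, v⋆⟩`. [folklore] -/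
theorem qfun_crit_eq_pairing {H : Matrix n n 𝕜} {r : n → 𝕜} {K : Submodule 𝕜 (n → 𝕜)} {vs : n → 𝕜} (hcrit : IsCrit H r K vs) :
    qfun H r vs = star r ⬝ᵥ vs := by
  have h := hcrit.2 vs hcrit.1
  rw [dotProduct_sub, sub_eq_zero] at h
  rw [qfun, ← h]
  abel

/-- **SLICE INDEPENDENCE**: two critical points of `qfun H r` on the SAME subspace `K` (e.g. the KKT columns of two different gauge slices whose
gauge multipliers do no work on `K`) have the same pairing `⟨r, v₁⟩ = ⟨r, v₂⟩`. [folklore] -/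
theorem pairing_eq_of_isCrit {H : Matrix n n 𝕜} (hH : H.PosSemidef) {r : n → 𝕜} {K : Submodule 𝕜 (n → 𝕜)} {v₁ v₂ : n → 𝕜}
    (h₁ : IsCrit H r K v₁) (h₂ : IsCrit H r K v₂) : star r ⬝ᵥ v₁ = star r ⬝ᵥ v₂ := by
  rw [← qfun_crit_eq_pairing h₁, ← qfun_crit_eq_pairing h₂]
  exact le_antisymm (qfun_le_of_isCrit hH h₂ h₁.1) (qfun_le_of_isCrit hH h₁ h₂.1)

omit [PartialOrder 𝕜] [StarOrderedRing 𝕜] in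
/-- **KKT ⟹ CRITICAL on the kernel of the hard rows**: `A v = 0` and `H v − r = Aᴴ lam` ⟹ `IsCrit H r (ker A) v`. [folklore] -/
theorem isCrit_ker_of_kkt {m : Type*} [Fintype m] {H : Matrix n n 𝕜} {A : Matrix m n 𝕜} {r v : n → 𝕜} {lam : m → 𝕜}
    (hv : A *ᵥ v = 0) (hkkt : H *ᵥ v - r = Aᴴ *ᵥ lam) : IsCrit H r (LinearMap.ker A.mulVecLin) v := by
  refine ⟨by simpa [LinearMap.mem_ker, Matrix.mulVecLin_apply] using hv, fun w hw => ?_⟩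
  have hw' : A *ᵥ w = 0 := by simpa [LinearMap.mem_ker, Matrix.mulVecLin_apply] using hw
  have e : r - H *ᵥ v = -(Aᴴ *ᵥ lam) := by rw [← hkkt]; abel
  rw [e, dotProduct_neg, ← conj_pairing A w lam, hw', star_zero, zero_dotProduct, neg_zero]

variable {nc nf : Type*} [Fintype nc] [Fintype nf]

/-- **(STAB) ⟹ THE FINE FUNCTIONAL IS BELOW THE COARSE ONE ALONG THE AVERAGING**: `(H_f − Cᴴ H_c C).PosSemidef` (one averaging step `C`
does not increase the energy) ⟹ `qfun H_f (Cᴴ r) v ≤ qfun H_c r (C v)` for all `r, v`. [folklore] -/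
theorem qfun_coarsen_le {Hf : Matrix nf nf 𝕜} {Hc : Matrix nc nc 𝕜} {C : Matrix nc nf 𝕜} (hstab : (Hf - Cᴴ * Hc * C).PosSemidef)
    (r : nc → 𝕜) (v : nf → 𝕜) : qfun Hf (Cᴴ *ᵥ r) v ≤ qfun Hc r (C *ᵥ v) := by
  have e1 : star (Cᴴ *ᵥ r) ⬝ᵥ v = star r ⬝ᵥ (C *ᵥ v) := by
    rw [conj_pairing, conjTranspose_conjTranspose]
  have e2 : star v ⬝ᵥ (Cᴴ *ᵥ r) = star (C *ᵥ v) ⬝ᵥ r := by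
    rw [conj_pairing]
  have e3 : star (C *ᵥ v) ⬝ᵥ (Hc *ᵥ (C *ᵥ v)) = star v ⬝ᵥ ((Cᴴ * Hc * C) *ᵥ v) := by
    rw [conj_pairing, mulVec_mulVec, mulVec_mulVec]
  have h0 := hstab.dotProduct_mulVec_nonneg v
  rw [sub_mulVec, dotProduct_sub, sub_nonneg] at h0
  simp only [qfun, e1, e2, e3]
  exact sub_le_sub_left h0 _

/-- **COARSENING MONOTONICITY OF THE COVARIANCE PAIRING (gauge form).**  Fine and coarse PSD forms `H_f, H_c` (degenerate allowed), an averaging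
`C` mapping the fine constraint space `K_f` into the coarse one `K_c`, (STAB) `(H_f − Cᴴ H_c C).PosSemidef`; `v_f` critical for `(H_f, Cᴴ r)` on
`K_f` and `v_c` critical for `(H_c, r)` on `K_c` (read: `v = Γ r`, the covariance column, for a source on which the gauge multiplier does no
work).  Then `⟨Cᴴ r, v_f⟩ ≤ ⟨r, v_c⟩`: the DECIMATED fine covariance is below the coarse covariance on `r`, whatever slices produced `v_f, v_c`. [folklore] -/
theorem pairing_coarsen_le {Hf : Matrix nf nf 𝕜} {Hc : Matrix nc nc 𝕜} (hHc : Hc.PosSemidef) {C : Matrix nc nf 𝕜}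
    (hstab : (Hf - Cᴴ * Hc * C).PosSemidef) {Kf : Submodule 𝕜 (nf → 𝕜)} {Kc : Submodule 𝕜 (nc → 𝕜)}
    (hK : ∀ v ∈ Kf, C *ᵥ v ∈ Kc) {r : nc → 𝕜} {vf : nf → 𝕜} {vc : nc → 𝕜} (hf : IsCrit Hf (Cᴴ *ᵥ r) Kf vf)
    (hc : IsCrit Hc r Kc vc) : star (Cᴴ *ᵥ r) ⬝ᵥ vf ≤ star r ⬝ᵥ vc := by
  rw [← qfun_crit_eq_pairing hf, ← qfun_crit_eq_pairing hc]
  exact (qfun_coarsen_le hstab r vf).trans (qfun_le_of_isCrit hHc hc (hK vf hf.1))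

/-- The same with the pairing written on the coarse side: `⟨r, C v_f⟩ ≤ ⟨r, v_c⟩`. [folklore] -/
theorem pairing_coarsen_le' {Hf : Matrix nf nf 𝕜} {Hc : Matrix nc nc 𝕜} (hHc : Hc.PosSemidef) {C : Matrix nc nf 𝕜}
    (hstab : (Hf - Cᴴ * Hc * C).PosSemidef) {Kf : Submodule 𝕜 (nf → 𝕜)} {Kc : Submodule 𝕜 (nc → 𝕜)}
    (hK : ∀ v ∈ Kf, C *ᵥ v ∈ Kc) {r : nc → 𝕜} {vf : nf → 𝕜} {vc : nc → 𝕜} (hf : IsCrit Hf (Cᴴ *ᵥ r) Kf vf)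
    (hc : IsCrit Hc r Kc vc) : star r ⬝ᵥ (C *ᵥ vf) ≤ star r ⬝ᵥ vc := by
  have h := pairing_coarsen_le hHc hstab hK hf hc
  rwa [conj_pairing, conjTranspose_conjTranspose] at h

end Variational

/-! ## §2 Positive definite forms: the pivot, the effective form and the fluctuation covariance under one coarsening step -/

section PD

variable {𝕜 : Type*} [Field 𝕜] [PartialOrder 𝕜] [StarRing 𝕜] [StarOrderedRing 𝕜]
variable {nc nf : Type*} [Fintype nc] [Fintype nf] [DecidableEq nc] [DecidableEq nf]
variable {Hf : Matrix nf nf 𝕜} {Hc : Matrix nc nc 𝕜} {C : Matrix nc nf 𝕜}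

/-- **(STAB) ⟹ THE DECIMATED FINE INVERSE IS BELOW THE COARSE INVERSE**: `0 < H_f`, `0 < H_c`, `Cᴴ H_c C ≤ H_f` ⟹ `C H_f⁻¹ Cᴴ ≤ H_c⁻¹`
(`pivot H_f C ≤ H_c⁻¹`).  Proof: completing the square (`MonotoneBlocks.pairing_sub_form_le`) at `g := C H_f⁻¹ Cᴴ x`, whose coarse energy is
at most its fine energy `⟨x, C H_f⁻¹ Cᴴ x⟩` by (STAB). [folklore] -/
theorem pivot_coarsen_le (hHf : Hf.PosDef) (hHc : Hc.PosDef) (hstab : (Hf - Cᴴ * Hc * C).PosSemidef) :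
    (Hc⁻¹ - pivot Hf C).PosSemidef := by
  have hfu := (isUnit_iff_isUnit_det _).mp hHf.isUnit
  have hcu := (isUnit_iff_isUnit_det _).mp hHc.isUnit
  have hi : (Hc⁻¹)ᴴ = Hc⁻¹ := hHc.isHermitian.inv
  have hP : (pivot Hf C).IsHermitian := pivot_conjTranspose hHf.isHermitian
  refine PosSemidef.of_dotProduct_mulVec_nonneg (hHc.isHermitian.inv.sub hP) fun x => ?_
  rw [sub_mulVec, dotProduct_sub, sub_nonneg]
  set v : nf → 𝕜 := Hf⁻¹ *ᵥ (Cᴴ *ᵥ x) with hv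
  set g : nc → 𝕜 := C *ᵥ v with hg
  have eX : pivot Hf C *ᵥ x = g := by
    rw [hg, hv, mulVec_mulVec, mulVec_mulVec, pivot]
  have h1 := pairing_sub_form_le Hc Hc⁻¹ hHc.posSemidef (by rw [hi, nonsing_inv_mul _ hcu, Matrix.one_mul]) x g
    (by rw [hi, nonsing_inv_mul _ hcu, one_mulVec]) (by rw [mul_nonsing_inv _ hcu, one_mulVec])
  have h2 : star g ⬝ᵥ (Hc *ᵥ g) ≤ star g ⬝ᵥ x := by
    have h := hstab.dotProduct_mulVec_nonneg v
    rw [sub_mulVec, dotProduct_sub, sub_nonneg] at h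
    have e3 : star g ⬝ᵥ (Hc *ᵥ g) = star v ⬝ᵥ ((Cᴴ * Hc * C) *ᵥ v) := by
      rw [hg, conj_pairing, mulVec_mulVec, mulVec_mulVec]
    have e4 : Hf *ᵥ v = Cᴴ *ᵥ x := by
      rw [hv, mulVec_mulVec, mul_nonsing_inv _ hfu, one_mulVec]
    have e5 : star v ⬝ᵥ (Hf *ᵥ v) = star g ⬝ᵥ x := by
      rw [e4, hg]
      exact (conj_pairing C v x).symm
    rw [e3, ← e5]
    exact h
  calc star x ⬝ᵥ (pivot Hf C *ᵥ x) = star x ⬝ᵥ g := by rw [eX]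
    _ ≤ star x ⬝ᵥ g + (star g ⬝ᵥ x - star g ⬝ᵥ (Hc *ᵥ g)) := le_add_of_nonneg_right (sub_nonneg.mpr h2)
    _ = star x ⬝ᵥ g + star g ⬝ᵥ x - star g ⬝ᵥ (Hc *ᵥ g) := (add_sub_assoc _ _ _).symm
    _ ≤ star x ⬝ᵥ (Hc⁻¹ *ᵥ x) := h1

/-- **(STAB) ⟹ (OSD)**: `0 < H_f`, `0 < H_c`, the averaging `C` with independent rows, `Cᴴ H_c C ≤ H_f` ⟹ `H_c ≤ Δ_eff(H_f, C)` — gen 1's one-step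
domination (OSD_j) of `MonotoneComposite` FOLLOWS from «one averaging step does not increase the energy». [folklore] -/
theorem effForm_coarsen_ge (hHf : Hf.PosDef) (hHc : Hc.PosDef) (hC : Function.Injective C.vecMul)
    (hstab : (Hf - Cᴴ * Hc * C).PosSemidef) : (effForm Hf C - Hc).PosSemidef := by
  have hcu := (isUnit_iff_isUnit_det _).mp hHc.isUnit
  have h := inv_antitone (pivot_posDef hHf hC) hHc.inv (pivot_coarsen_le hHf hHc hstab)
  rwa [Matrix.nonsing_inv_nonsing_inv _ hcu] at h

omit [StarOrderedRing 𝕜] in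
/-- **THE EFFECTIVE FORM NEVER EXCEEDS THE ENERGY OF A PREIMAGE**: `Cᴴ Δ_eff(H_f, C) C ≤ H_f` (`= H_f Γ H_f ⪰ 0`). [folklore] -/
theorem form_sub_effForm_conj (hHf : Hf.PosDef) (hC : Function.Injective C.vecMul) :
    (Hf - Cᴴ * effForm Hf C * C).PosSemidef := by
  have hfu := (isUnit_iff_isUnit_det _).mp hHf.isUnit
  have h := (flucCov_posSemidef hHf hC).conjTranspose_mul_mul_same Hf
  have e : Hfᴴ * flucCov Hf C * Hf = Hf - Cᴴ * effForm Hf C * C := by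
    rw [hHf.isHermitian.eq, flucCov, Matrix.mul_sub, Matrix.sub_mul, mul_nonsing_inv _ hfu, Matrix.one_mul]
    simp only [Matrix.mul_assoc]
    rw [nonsing_inv_mul _ hfu, Matrix.mul_one, Matrix.mul_nonsing_inv_cancel_left _ _ hfu]
  rwa [e] at h

/-- **(OSD) ⟹ (STAB)**: conversely `H_c ≤ Δ_eff(H_f, C)` ⟹ `Cᴴ H_c C ≤ H_f`.  Hence (OSD_j) ⟺ (STAB_j): the located inequality of road P4 IS the
stability of the averaging step. [folklore] -/
theorem stab_of_osd (hHf : Hf.PosDef) (hC : Function.Injective C.vecMul) (hosd : (effForm Hf C - Hc).PosSemidef) :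
    (Hf - Cᴴ * Hc * C).PosSemidef := by
  have h1 := form_sub_effForm_conj hHf hC
  have h2 := hosd.conjTranspose_mul_mul_same C
  have e : Hf - Cᴴ * Hc * C = (Hf - Cᴴ * effForm Hf C * C) + Cᴴ * (effForm Hf C - Hc) * C := by
    rw [Matrix.mul_sub, Matrix.sub_mul]
    abel
  rw [e]
  exact h1.add h2

variable {m : Type*} [Fintype m] [DecidableEq m] {Q : Matrix m nc 𝕜}

/-- **COARSENING MONOTONICITY OF THE FLUCTUATION COVARIANCE**: (STAB) ⟹ `C Γ(H_f, Q C) Cᴴ ≤ Γ(H_c, Q)` — the fine covariance of the composite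
constraint `Q C`, decimated by the averaging `C`, is below the coarse covariance (p3's composition law `decimate_flucCov_comp` + gen 1's
`flucCov_antitone` at (OSD)). [folklore] -/
theorem flucCov_coarsen_antitone (hHf : Hf.PosDef) (hHc : Hc.PosDef) (hC : Function.Injective C.vecMul)
    (hstab : (Hf - Cᴴ * Hc * C).PosSemidef) (hQ : Function.Injective Q.vecMul) :
    (flucCov Hc Q - C * flucCov Hf (Q * C) * Cᴴ).PosSemidef := by
  rw [decimate_flucCov_comp (isUnit_pivot_of_posDef hHf hC) Q]
  exact flucCov_antitone hHc (effForm_posDef hHf hC) (effForm_coarsen_ge hHf hHc hC hstab) hQ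

/-- … and the next effective form increases: `Δ_eff(H_c, Q) ≤ Δ_eff(H_f, Q C)` (p3's `effForm_comp` + gen 1's `effForm_monotone`). [folklore] -/
theorem effForm_coarsen_monotone (hHf : Hf.PosDef) (hHc : Hc.PosDef) (hC : Function.Injective C.vecMul)
    (hstab : (Hf - Cᴴ * Hc * C).PosSemidef) (hQ : Function.Injective Q.vecMul) :
    (effForm Hf (Q * C) - effForm Hc Q).PosSemidef := by
  rw [effForm_comp (isUnit_pivot_of_posDef hHf hC) Q]
  exact effForm_monotone hHc (effForm_posDef hHf hC) (effForm_coarsen_ge hHf hHc hC hstab) hQ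

/-- The reading-decimated form: for any reading matrix `R` on the coarse legs, `R C Γ(H_f, Q C) Cᴴ Rᴴ ≤ R Γ(H_c, Q) Rᴴ`. [folklore] -/
theorem read_flucCov_coarsen_antitone {l : Type*} [Fintype l] (hHf : Hf.PosDef) (hHc : Hc.PosDef)
    (hC : Function.Injective C.vecMul) (hstab : (Hf - Cᴴ * Hc * C).PosSemidef) (hQ : Function.Injective Q.vecMul)
    (R : Matrix l nc 𝕜) : (R * flucCov Hc Q * Rᴴ - (R * C) * flucCov Hf (Q * C) * (R * C)ᴴ).PosSemidef := by
  have h := (flucCov_coarsen_antitone hHf hHc hC hstab hQ).mul_mul_conjTranspose_same R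
  have e : R * (flucCov Hc Q - C * flucCov Hf (Q * C) * Cᴴ) * Rᴴ =
      R * flucCov Hc Q * Rᴴ - (R * C) * flucCov Hf (Q * C) * (R * C)ᴴ := by
    rw [Matrix.mul_sub, Matrix.sub_mul, conjTranspose_mul]
    simp only [Matrix.mul_assoc]
  rwa [e] at h

end PD

/-! ## §3 The tower of `MonotoneComposite` driven by (STAB_j) instead of (OSD_j) -/

section Tower

variable {𝕜 : Type*} [Field 𝕜] [PartialOrder 𝕜] [StarRing 𝕜] [StarOrderedRing 𝕜]
variable {c : Type*} [Fintype c] [DecidableEq c]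
variable {ι : ℕ → Type*} [∀ j, Fintype (ι j)] [∀ j, DecidableEq (ι j)]
variable {H : ∀ j, Matrix (ι j) (ι j) 𝕜} {Qf : ∀ j, Matrix (ι j) (ι (j + 1)) 𝕜} {Qc : ∀ j, Matrix c (ι j) 𝕜} {k₀ : ℕ}

/-- **(STAB_j) ⟹ (OSD_j)** along a tower: `(Qf j)ᴴ (H j) (Qf j) ≤ H (j+1)` for `j ≥ k₀` ⟹ `H j ≤ Δ_eff(H (j+1), Qf j)` for `j ≥ k₀`. [folklore] -/
theorem osd_of_stab (hH : ∀ j, (H j).PosDef) (hQf : ∀ j, Function.Injective (Qf j).vecMul)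
    (hstab : ∀ j, k₀ ≤ j → (H (j + 1) - (Qf j)ᴴ * H j * Qf j).PosSemidef) :
    ∀ j, k₀ ≤ j → (effForm (H (j + 1)) (Qf j) - H j).PosSemidef := fun j hj =>
  effForm_coarsen_ge (hH (j + 1)) (hH j) (hQf j) (hstab j hj)

/-- **(STAB) ⟹ THE COMPOSITE EFFECTIVE FORMS INCREASE** (`MonotoneComposite.effForm_chain_step` at (OSD) := `osd_of_stab`). [folklore] -/
theorem effForm_chain_step_of_stab (hH : ∀ j, (H j).PosDef) (hQf : ∀ j, Function.Injective (Qf j).vecMul)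
    (hQc : ∀ j, Function.Injective (Qc j).vecMul) (hcomp : ∀ j, Qc (j + 1) = Qc j * Qf j)
    (hstab : ∀ j, k₀ ≤ j → (H (j + 1) - (Qf j)ᴴ * H j * Qf j).PosSemidef) :
    ∀ j, k₀ ≤ j → (effForm (H (j + 1)) (Qc (j + 1)) - effForm (H j) (Qc j)).PosSemidef :=
  MonotoneComposite.effForm_chain_step hH hQf hQc hcomp (osd_of_stab hH hQf hstab)

variable {m : Type*} [Fintype m] [DecidableEq m] {Q : Matrix m c 𝕜}

/-- **(STAB) ⟹ THE ONE-STEP COVARIANCE OVER THE COMPOSITE FORM DECREASES** (`MonotoneComposite.flucCov_chain_step` at `osd_of_stab`). [folklore] -/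
theorem flucCov_chain_step_of_stab (hH : ∀ j, (H j).PosDef) (hQf : ∀ j, Function.Injective (Qf j).vecMul)
    (hQc : ∀ j, Function.Injective (Qc j).vecMul) (hcomp : ∀ j, Qc (j + 1) = Qc j * Qf j)
    (hstab : ∀ j, k₀ ≤ j → (H (j + 1) - (Qf j)ᴴ * H j * Qf j).PosSemidef) (hQ : Function.Injective Q.vecMul) :
    ∀ j, k₀ ≤ j → (flucCov (effForm (H j) (Qc j)) Q - flucCov (effForm (H (j + 1)) (Qc (j + 1))) Q).PosSemidef :=
  MonotoneComposite.flucCov_chain_step hH hQf hQc hcomp (osd_of_stab hH hQf hstab) hQ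

end Tower

/-! ## Over `ℂ`: (STAB) at every level `j ≥ k₀` + ONE trace datum ⟹ (MONO-K)₂ for the `Γ`-block -/

section Complex

open scoped ComplexOrder
open Summit.QuantumFields.BalabanUV.Beta.CapRowsTail (MonotoneTailDown)

variable {c : Type*} [Fintype c] [DecidableEq c]
variable {ι : ℕ → Type*} [∀ j, Fintype (ι j)] [∀ j, DecidableEq (ι j)]
variable {H : ∀ j, Matrix (ι j) (ι j) ℂ} {Qf : ∀ j, Matrix (ι j) (ι (j + 1)) ℂ} {Qc : ∀ j, Matrix c (ι j) ℂ} {k₀ : ℕ}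
variable {m : Type*} [Fintype m] [DecidableEq m] {Q : Matrix m c ℂ}

/-- **(STAB_j) FOR `j ≥ k₀` + ONE TRACE DATUM ⟹ (MONO-K)₂ FOR THE `Γ`-BLOCK, NO RATE** (`MonotoneComposite.flucCov_entry_dev_le_of_osd` at
`osd_of_stab`): every entry of `Γ(E j, Q) − Γ(E j', Q)` (`j, j' ≥ k₀`, `E j := Δ_eff(H j, Qc j)`) is bounded by the trace lost after `k₀`, and the
trace majorant is non-increasing (an5's socket `MonotoneTailDown`). [folklore] -/
theorem flucCov_entry_dev_le_of_stab (hH : ∀ j, (H j).PosDef) (hQf : ∀ j, Function.Injective (Qf j).vecMul)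
    (hQc : ∀ j, Function.Injective (Qc j).vecMul) (hcomp : ∀ j, Qc (j + 1) = Qc j * Qf j)
    (hstab : ∀ j, k₀ ≤ j → (H (j + 1) - (Qf j)ᴴ * H j * Qf j).PosSemidef) (hQ : Function.Injective Q.vecMul) {η₀ : ℝ}
    (hdat : ∀ j, k₀ ≤ j →
      (flucCov (effForm (H k₀) (Qc k₀)) Q - flucCov (effForm (H j) (Qc j)) Q).trace.re ≤ η₀) :
    (∀ j j', k₀ ≤ j → k₀ ≤ j' → ∀ a b,
        ‖(flucCov (effForm (H j) (Qc j)) Q - flucCov (effForm (H j') (Qc j')) Q) a b‖ ≤ η₀) ∧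
      MonotoneTailDown (fun j => (flucCov (effForm (H j) (Qc j)) Q).trace.re) k₀ :=
  MonotoneComposite.flucCov_entry_dev_le_of_osd hH hQf hQc hcomp (osd_of_stab hH hQf hstab) hQ hdat

end Complex

/-! ## §4 (v1.1, append-only) GAUGE SLICES: a critical point on `K ⊓ S` is critical on `K` when the source is invariant under gauge motions that sweep `K` into the slice
(the located mechanism behind finding (C) of asym1-g19 «MONOTRANS»: monotonicity holds on every source orthogonal to the gauge motions `T` for which `K ≤ K ⊓ S ⊔ T` —
slice legitimacy — e.g. `T = {dλ : block sums of λ constant}` for an2's weak block-Landau slice, sources with BLOCK-CONSTANT divergence) -/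

section Slice

variable {𝕜 : Type*} [Field 𝕜] [PartialOrder 𝕜] [StarRing 𝕜] [StarOrderedRing 𝕜]
variable {n : Type*} [Fintype n]

omit [PartialOrder 𝕜] [StarOrderedRing 𝕜] in
/-- **SLICE LEGITIMACY ⟹ CRITICALITY ON THE GAUGE-FREE SPACE.**  `H` Hermitian; `v` critical for `(H, r)` on the slice `K ⊓ S`; a subspace `T` of GAUGE MOTIONS
with `H t = 0` (degenerate directions) and `⟨t, r⟩ = 0` (the source is invariant) for `t ∈ T`, such that `K ≤ K ⊓ S ⊔ T` (every admissible field can be moved into the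
slice by a gauge motion).  Then `v` is critical on the whole of `K` — so `pairing_eq_of_isCrit` (slice independence) and `pairing_coarsen_le` apply with the gauge-FREE
`K`. [folklore] -/
theorem isCrit_of_slice {H : Matrix n n 𝕜} (hH : H.IsHermitian) {r : n → 𝕜} {K S T : Submodule 𝕜 (n → 𝕜)} {v : n → 𝕜}
    (hcrit : IsCrit H r (K ⊓ S) v) (hKST : K ≤ K ⊓ S ⊔ T) (hHT : ∀ t ∈ T, H *ᵥ t = 0) (hrT : ∀ t ∈ T, star t ⬝ᵥ r = 0) :
    IsCrit H r K v := by
  refine ⟨(Submodule.mem_inf.mp hcrit.1).1, fun w hw => ?_⟩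
  obtain ⟨s, hs, t, ht, rfl⟩ := Submodule.mem_sup.mp (hKST hw)
  have h1 : star s ⬝ᵥ (r - H *ᵥ v) = 0 := hcrit.2 s hs
  have h2 : star t ⬝ᵥ (H *ᵥ v) = 0 := by
    rw [← conjTranspose_conjTranspose H, ← conj_pairing, hH.eq, hHT t ht, star_zero, zero_dotProduct]
  rw [star_add, add_dotProduct, h1, zero_add, dotProduct_sub, hrT t ht, h2, sub_zero]

omit [PartialOrder 𝕜] [StarOrderedRing 𝕜] in
/-- KKT with TWO row blocks (constraints `A`, gauge rows `G`): `A v = 0`, `G v = 0`, `H v − r = Aᴴ φ + Gᴴ μ` ⟹ critical on `ker A ⊓ ker G`. [folklore] -/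
theorem isCrit_inf_of_kkt₂ {m m' : Type*} [Fintype m] [Fintype m'] {H : Matrix n n 𝕜} {A : Matrix m n 𝕜} {G : Matrix m' n 𝕜}
    {r v : n → 𝕜} {φ : m → 𝕜} {μ : m' → 𝕜} (hA : A *ᵥ v = 0) (hG : G *ᵥ v = 0) (hkkt : H *ᵥ v - r = Aᴴ *ᵥ φ + Gᴴ *ᵥ μ) :
    IsCrit H r (LinearMap.ker A.mulVecLin ⊓ LinearMap.ker G.mulVecLin) v := by
  refine ⟨Submodule.mem_inf.mpr ⟨by simpa [LinearMap.mem_ker, Matrix.mulVecLin_apply] using hA,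
    by simpa [LinearMap.mem_ker, Matrix.mulVecLin_apply] using hG⟩, fun w hw => ?_⟩
  obtain ⟨hwA, hwG⟩ := Submodule.mem_inf.mp hw
  have hwA' : A *ᵥ w = 0 := by simpa [LinearMap.mem_ker, Matrix.mulVecLin_apply] using hwA
  have hwG' : G *ᵥ w = 0 := by simpa [LinearMap.mem_ker, Matrix.mulVecLin_apply] using hwG
  have e : r - H *ᵥ v = -(Aᴴ *ᵥ φ + Gᴴ *ᵥ μ) := by rw [← hkkt]; abel
  rw [e, dotProduct_neg, dotProduct_add, ← conj_pairing A w φ, ← conj_pairing G w μ, hwA', hwG']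
  simp only [star_zero, zero_dotProduct, add_zero, neg_zero]

omit [PartialOrder 𝕜] [StarOrderedRing 𝕜] in
/-- **WHEN THE GAUGE MULTIPLIER DOES NO WORK**: in the two-block KKT situation, if moreover the gauge term `Gᴴ μ` is orthogonal to `ker A` (e.g. `μ = 0`, an5's
`McolSum_eq_zero` for co-closed sources), then `v` is critical on the gauge-FREE constraint space `ker A`. [folklore] -/
theorem isCrit_ker_of_kkt₂ {m m' : Type*} [Fintype m] [Fintype m'] {H : Matrix n n 𝕜} {A : Matrix m n 𝕜} {G : Matrix m' n 𝕜}
    {r v : n → 𝕜} {φ : m → 𝕜} {μ : m' → 𝕜} (hA : A *ᵥ v = 0) (hkkt : H *ᵥ v - r = Aᴴ *ᵥ φ + Gᴴ *ᵥ μ)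
    (hμ : ∀ w, A *ᵥ w = 0 → star w ⬝ᵥ (Gᴴ *ᵥ μ) = 0) : IsCrit H r (LinearMap.ker A.mulVecLin) v := by
  refine ⟨by simpa [LinearMap.mem_ker, Matrix.mulVecLin_apply] using hA, fun w hw => ?_⟩
  have hwA' : A *ᵥ w = 0 := by simpa [LinearMap.mem_ker, Matrix.mulVecLin_apply] using hw
  have e : r - H *ᵥ v = -(Aᴴ *ᵥ φ + Gᴴ *ᵥ μ) := by rw [← hkkt]; abel
  rw [e, dotProduct_neg, dotProduct_add, ← conj_pairing A w φ, hwA', star_zero, zero_dotProduct, zero_add, hμ w hwA', neg_zero]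

end Slice

end Summit.QuantumFields.BalabanUV.Beta.GAN24.MonotoneCoarsen
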